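import Mathlib.Analysis.Convex.Slope
import Mathlib.Order.Bounds.Basic
import Mathlib.Tactic
import HarnessLib

/-!
# Non-negative affine majorants of a concave, non-decreasing, subhomogeneous function on a ray

On a ray `[a, ∞)` (`a > 0`) let `g` be concave, non-decreasing, with `x ↦ g x / x` non-increasing
("subhomogeneous") and `g a ≥ 0`.  Then `g` is, at every point `x₀ ≥ a` and to every accuracy
`ε > 0`, touched from above by an AFFINE majorant `x ↦ d + b·x` with NON-NEGATIVE coefficients
`d, b ≥ 0` (`exists_affine_majorant_le_add`); equivalently `g x₀` is the infimum of the values at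
`x₀` of all such majorants (`isGLB_affine_majorants`).

This is the supporting-line property of concave functions with the two sign constraints read off
from the shape hypotheses: the slope of a supporting line is `≥ 0` because `g` is non-decreasing and
its intercept is `≥ 0` because `g x / x` is non-increasing (`g(x₀) - x₀·g'(x₀) ≥ 0`).  We avoid
one-sided derivatives altogether: the RIGHT secant through `x₀` and `x₀ + δ` already majorises `g`
outside `(x₀, x₀ + δ)` (three-slope inequality, Mathlib `ConcaveOn.slope_anti_adjacent`), and on
`(x₀, x₀ + δ)` the defect is at most `(g x₀ / x₀)·δ` by subhomogeneity, so lifting the secant by that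
amount gives a majorant touching within `(g x₀ / x₀)·δ`.

Use (tree): restricted to the positive real axis, `d + b·Re z` (`d, b ≥ 0`) is a non-negative
harmonic function on the right half-plane, so such `g` are traces of infima of non-negative harmonic
functions ("Harnack hull"; `Summits/QuantumFields/QCD`, crux `EulerDescent.RayDescent`, line
`Sketch`).  Elementary; [folklore] (e.g. R. T. Rockafellar, *Convex Analysis* (1970), §12, envelope
representation of closed concave functions — here with explicit sign bookkeeping and no closure
hypothesis, the domain being a closed ray and the touching only `ε`-approximate).
-/

namespace Literature.Analysis.Convex

open Set

/-- **Right secants of a concave function majorise it to the left of the secant.**  For `g` concave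
on `[a, ∞)` and `a ≤ x < x₀ < x₁`: `g x ≤ g x₀ + τ (x - x₀)` with `τ` the slope of the secant through
`x₀, x₁`. [folklore] -/
theorem le_rightSecant_of_lt_of_concaveOn {g : ℝ → ℝ} {a : ℝ} (hg : ConcaveOn ℝ (Ici a) g)
    {x x₀ x₁ : ℝ} (hx : a ≤ x) (hxx₀ : x < x₀) (hx₀x₁ : x₀ < x₁) :
    g x ≤ g x₀ + (g x₁ - g x₀) / (x₁ - x₀) * (x - x₀) := by
  have hx₁ : x₁ ∈ Ici a := le_trans hx (le_of_lt (hxx₀.trans hx₀x₁))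
  have h := hg.slope_anti_adjacent (x := x) (y := x₀) (z := x₁) hx hx₁ hxx₀ hx₀x₁
  -- `τ ≤ (g x₀ - g x)/(x₀ - x)` with `x₀ - x > 0`
  have hpos : 0 < x₀ - x := sub_pos.2 hxx₀
  have h' : (g x₁ - g x₀) / (x₁ - x₀) * (x₀ - x) ≤ g x₀ - g x := by
    have := mul_le_mul_of_nonneg_right h hpos.le
    rwa [div_mul_cancel₀ _ hpos.ne'] at this
  nlinarith

/-- **Right secants of a concave function majorise it to the right of the secant.**  For `g`
concave on `[a, ∞)` and `a ≤ x₀ < x₁ < x`: `g x ≤ g x₀ + τ (x - x₀)` with `τ` the slope of the secant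
through `x₀, x₁`. [folklore] -/
theorem le_rightSecant_of_gt_of_concaveOn {g : ℝ → ℝ} {a : ℝ} (hg : ConcaveOn ℝ (Ici a) g)
    {x x₀ x₁ : ℝ} (hx₀ : a ≤ x₀) (hx₀x₁ : x₀ < x₁) (hx₁x : x₁ < x) :
    g x ≤ g x₀ + (g x₁ - g x₀) / (x₁ - x₀) * (x - x₀) := by
  have hx : x ∈ Ici a := le_trans hx₀ (le_of_lt (hx₀x₁.trans hx₁x))
  have h := hg.slope_anti_adjacent (x := x₀) (y := x₁) (z := x) hx₀ hx hx₀x₁ hx₁x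
  -- `(g x - g x₁)/(x - x₁) ≤ τ` with `x - x₁ > 0`
  have hpos : 0 < x - x₁ := sub_pos.2 hx₁x
  have hδ : 0 < x₁ - x₀ := sub_pos.2 hx₀x₁
  have h' : g x - g x₁ ≤ (g x₁ - g x₀) / (x₁ - x₀) * (x - x₁) := by
    have := mul_le_mul_of_nonneg_right h hpos.le
    rwa [div_mul_cancel₀ _ hpos.ne'] at this
  have hid : (g x₁ - g x₀) / (x₁ - x₀) * (x - x₀)
      = (g x₁ - g x₀) / (x₁ - x₀) * (x - x₁) + (g x₁ - g x₀) := by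
    rw [show x - x₀ = (x - x₁) + (x₁ - x₀) by ring, mul_add, div_mul_cancel₀ _ hδ.ne']
  rw [hid]
  linarith

/-- **`ε`-supporting affine majorants with non-negative coefficients.**  Let `a > 0` and let
`g : ℝ → ℝ` be concave and non-decreasing on `[a, ∞)` with `x ↦ g x / x` non-increasing there and
`0 ≤ g a`.  Then for every `x₀ ≥ a` and `ε > 0` there are `d, b ≥ 0` with `g x ≤ d + b x` for all
`x ≥ a` and `d + b x₀ ≤ g x₀ + ε`.  (Construction: the right secant through `x₀` and
`x₀ + δ`, `δ = ε x₀ / (g x₀ + x₀)`, lifted by `(g x₀ / x₀)·δ`.) [folklore] -/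
theorem exists_affine_majorant_le_add {g : ℝ → ℝ} {a : ℝ} (ha : 0 < a)
    (hconc : ConcaveOn ℝ (Ici a) g) (hmono : MonotoneOn g (Ici a))
    (hsub : AntitoneOn (fun x => g x / x) (Ici a)) (hg0 : 0 ≤ g a)
    {x₀ : ℝ} (hx₀ : a ≤ x₀) {ε : ℝ} (hε : 0 < ε) :
    ∃ d b : ℝ, 0 ≤ d ∧ 0 ≤ b ∧ (∀ x, a ≤ x → g x ≤ d + b * x) ∧ d + b * x₀ ≤ g x₀ + ε := by
  have hx₀pos : 0 < x₀ := ha.trans_le hx₀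
  have hgx₀ : 0 ≤ g x₀ := hg0.trans (hmono (le_refl a) hx₀ hx₀)
  -- subhomogeneity from `x₀`: `g x ≤ (g x₀ / x₀) · x` for `x ≥ x₀`
  set K : ℝ := g x₀ / x₀ with hK
  have hKnn : 0 ≤ K := div_nonneg hgx₀ hx₀pos.le
  have hKx₀ : K * x₀ = g x₀ := by rw [hK, div_mul_cancel₀ _ hx₀pos.ne']
  have hsubx : ∀ x, x₀ ≤ x → g x ≤ K * x := by
    intro x hx
    have hxpos : 0 < x := hx₀pos.trans_le hx
    have h : g x / x ≤ g x₀ / x₀ := hsub hx₀ (hx₀.trans hx) hx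
    rwa [div_le_iff₀ hxpos, ← hK] at h
  -- the step `δ` and the right secant slope `τ`
  set δ : ℝ := ε / (K + 1) with hδ
  have hK1 : 0 < K + 1 := by linarith
  have hδpos : 0 < δ := div_pos hε hK1
  have hKδ : K * δ ≤ ε := by
    rw [hδ, mul_div_assoc']
    rw [div_le_iff₀ hK1]
    nlinarith
  set x₁ : ℝ := x₀ + δ with hx₁
  have hx₀x₁ : x₀ < x₁ := by rw [hx₁]; linarith
  have hx₁a : a ≤ x₁ := hx₀.trans hx₀x₁.le
  set τ : ℝ := (g x₁ - g x₀) / (x₁ - x₀) with hτ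
  have hx₁x₀ : x₁ - x₀ = δ := by rw [hx₁]; ring
  have hτnn : 0 ≤ τ := by
    rw [hτ]
    exact div_nonneg (sub_nonneg.2 (hmono hx₀ hx₁a hx₀x₁.le)) (by rw [hx₁x₀]; exact hδpos.le)
  have hτK : τ ≤ K := by
    rw [hτ, div_le_iff₀ (by rw [hx₁x₀]; exact hδpos), hx₁x₀]
    have h1 : g x₁ ≤ K * x₁ := hsubx x₁ hx₀x₁.le
    have h2 : K * x₁ = K * x₀ + K * δ := by rw [hx₁]; ring
    linarith
  -- the majorant `h x = (g x₀ - τ x₀ + K δ) + τ x`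
  refine ⟨g x₀ - τ * x₀ + K * δ, τ, ?_, hτnn, ?_, ?_⟩
  · -- intercept `≥ 0`: `τ x₀ ≤ K x₀ = g x₀`
    have : τ * x₀ ≤ K * x₀ := mul_le_mul_of_nonneg_right hτK hx₀pos.le
    nlinarith
  · intro x hx
    -- it suffices: `g x ≤ g x₀ + τ (x - x₀) + K δ`
    suffices h : g x ≤ g x₀ + τ * (x - x₀) + K * δ by linarith
    have hKδnn : 0 ≤ K * δ := mul_nonneg hKnn hδpos.le
    rcases lt_trichotomy x x₀ with hlt | heq | hgt
    · -- left of `x₀`: the secant majorises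
      have := le_rightSecant_of_lt_of_concaveOn hconc hx hlt hx₀x₁
      rw [← hτ] at this
      linarith
    · subst heq
      simp only [sub_self, mul_zero, add_zero]
      linarith
    · rcases lt_trichotomy x x₁ with hlt₁ | heq₁ | hgt₁
      · -- inside `(x₀, x₁)`: subhomogeneity, defect `≤ K δ`
        have h1 : g x ≤ K * x := hsubx x hgt.le
        have h2 : K * x ≤ K * x₀ + K * δ := by
          have : x ≤ x₀ + δ := by rw [← hx₁]; exact hlt₁.le
          nlinarith
        have h3 : 0 ≤ τ * (x - x₀) := mul_nonneg hτnn (by linarith)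
        linarith
      · -- at `x₁`: equality on the secant
        subst heq₁
        have : τ * (x₁ - x₀) = g x₁ - g x₀ := by
          rw [hτ, div_mul_cancel₀ _ (by rw [hx₁x₀]; exact hδpos.ne')]
        linarith
      · -- right of `x₁`: the secant majorises
        have := le_rightSecant_of_gt_of_concaveOn hconc hx₀ hx₀x₁ hgt₁
        rw [← hτ] at this
        linarith
  · -- touching within `ε` at `x₀`
    have : g x₀ - τ * x₀ + K * δ + τ * x₀ = g x₀ + K * δ := by ring
    rw [this]
    linarith

/-- **Envelope form.**  Under the hypotheses of `exists_affine_majorant_le_add`, `g x₀` is the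
greatest lower bound of the values at `x₀` of the affine majorants of `g` on `[a, ∞)` with
non-negative coefficients: `g = inf {d + b·x : d, b ≥ 0, d + b·(·) ≥ g on [a, ∞)}` pointwise on the
ray. [folklore] -/
theorem isGLB_affine_majorants {g : ℝ → ℝ} {a : ℝ} (ha : 0 < a)
    (hconc : ConcaveOn ℝ (Ici a) g) (hmono : MonotoneOn g (Ici a))
    (hsub : AntitoneOn (fun x => g x / x) (Ici a)) (hg0 : 0 ≤ g a)
    {x₀ : ℝ} (hx₀ : a ≤ x₀) :
    IsGLB {y : ℝ | ∃ d b : ℝ, 0 ≤ d ∧ 0 ≤ b ∧ (∀ x, a ≤ x → g x ≤ d + b * x) ∧ y = d + b * x₀}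
      (g x₀) := by
  constructor
  · rintro y ⟨d, b, -, -, hmaj, rfl⟩
    exact hmaj x₀ hx₀
  · intro y hy
    -- `y` is a lower bound of the set; show `y ≤ g x₀` by `ε`-approximation
    refine le_of_forall_pos_le_add fun ε hε => ?_
    obtain ⟨d, b, hd, hb, hmaj, hle⟩ :=
      exists_affine_majorant_le_add ha hconc hmono hsub hg0 hx₀ hε
    exact (hy ⟨d, b, hd, hb, hmaj, rfl⟩).trans hle

end Literature.Analysis.Convex
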